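import Summits.ResolutionOfSingularities.ResolutionOfSingularities.Theorems.FrobeniusLadderFRationalResolutionSingBlowupRound
import Summits.ResolutionOfSingularities.ResolutionOfSingularities.Theorems.SectionAscentAffineToGlobalAffineSingularLocus
import HarnessLib

/-!
# Crux `FrobeniusLadder.FRationalResolution` (stmt-ResolutionOfSingularities-15317), line `redirect`,
# stub `stub_diagonalizableQuotientResolution` — **the global round at a point WITH BOOKKEEPING of the new roof**
# (design C3 = the rank-2 stratum layer of the non-isolated case, L3-b: what the propagation of the pointwise
# singular-locus description `hSing` to the chart `C_h` of the round needs to know about the new étale roof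
# `X₁ ←ρ'— Y' —j'↪ Spec C_h` of `…SingBlowupRound.exists_chart_of_singular_point`)

* `exists_roof_of_chart_point'` — lineage 2's `…ConeChartRecursion.exists_roof_of_chart_point` with the inclusion
  `ι'' : Y' ↪ Y₁` exposed and, for EVERY point `y₃` of the roof, `π_J` of its image in `Bl_J` is the contraction of
  `j' y₃` to `R`, and regularity of `𝒪_{Bl_J}` there is regularity of `(R[J/x])_{j' y₃}`;
* `isRegularLocalRing_stalk_iff_of_not_le` — off `V(J)` the affine blow-up has the local rings of the base
  (`affineBlowup.isIso_morphismRestrict_iSup`; `𝒪_{Spec A, y} ≅ A_y` by the tree's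
  `AffineToGlobal.AffineSingularLocus.isRegularLocalRing_stalk_Spec_iff`);
* **`exists_chart_of_singular_point'`** — `…SingBlowupRound.exists_chart_of_singular_point` and moreover, for every
  point `y₃` of the new roof: a point `y₀` of the old roof with `(j' y₃) ∩ C = j y₀`; regularity of `(C_h)_{j' y₃}` iff
  `ρ' y₃ ∈ Reg X₁`; and, when `j y₀ ⊉ (χ s)` (off the exceptional divisor), iff regularity of `C_{j y₀}`.

Honest label: assembly/bookkeeping toward ONE leaf stub (no stub, crux or summit closed). No definitions, no named
facts, no sorry. [cite: GortzWedhorn2020, Prop. 13.91, (13.19) p. 415] [cite: StacksProject, Tag 02OS]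
-/

noncomputable section

-- single-problem summit: the doubled namespace component is forced
set_option linter.dupNamespace false

open CategoryTheory CategoryTheory.Limits AlgebraicGeometry TopologicalSpace
open IsLocalRing Literature.AlgebraicGeometry.Resolution Literature.AlgebraicGeometry.Resolution.LogChart
open Summit.ResolutionOfSingularities.ResolutionOfSingularities.Theorems.FRationalResolution

namespace Summit.ResolutionOfSingularities.ResolutionOfSingularities.Theorems.FRationalResolution.SingBlowupRoundRoof

set_option maxHeartbeats 400000 in
/-- **The étale roof at a point of a chart of `Bl_J`, with bookkeeping.** [cite: GortzWedhorn2020, Prop. 13.91, (13.19)] -/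
theorem exists_roof_of_chart_point' {R : Type} [CommRing R] (J : Ideal R) (x : R) (hx : x ∈ J)
    {Y₁ X₁ : Scheme.{0}} (Ψ : Y₁ ⟶ affineBlowup J) [IsOpenImmersion Ψ] (Φ₁ : Y₁ ⟶ X₁) [Etale Φ₁] (y : Y₁)
    (q : Spec (.of (HomogeneousLocalization.Away (reesGrading J) (reesT x hx))))
    (𝔔 : Ideal (blowupAlgebra J x))
    (hpq : Proj.awayι (reesGrading J) (reesT x hx) (reesT_mem x hx) one_pos q = Ψ y)
    (hmemq : ∀ t, t ∈ q.asIdeal ↔ reesChartEquiv (I := J) x hx t ∈ 𝔔) :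
    ∃ (Y : Scheme.{0}) (ρ : Y ⟶ X₁) (_ : Etale ρ) (j : Y ⟶ Spec (.of (blowupAlgebra J x)))
      (_ : IsOpenImmersion j) (ι : Y ⟶ Y₁) (_ : IsOpenImmersion ι) (y₁ : Y),
      ρ = ι ≫ Φ₁ ∧ ι y₁ = y ∧ (j y₁).asIdeal = 𝔔 ∧
      ∀ y₃ : Y, (affineBlowup.π J (Ψ (ι y₃))).asIdeal =
          ((j y₃).asIdeal).comap (algebraMap R (blowupAlgebra J x)) ∧
        (IsRegularLocalRing ((affineBlowup J).presheaf.stalk (Ψ (ι y₃))) ↔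
          IsRegularLocalRing (Localization.AtPrime (j y₃).asIdeal)) := by
  let eh := RingEquiv.toCommRingCatIso (R := HomogeneousLocalization.Away (reesGrading J) (reesT x hx))
    (S := blowupAlgebra J x) (reesChartEquiv (I := J) x hx)
  let aw := Proj.awayι (reesGrading J) (reesT x hx) (reesT_mem x hx) one_pos
  let fh : Spec (.of (blowupAlgebra J x)) ⟶ affineBlowup J := Spec.map eh.hom ≫ aw
  haveI hfh : IsOpenImmersion fh := by
    show IsOpenImmersion (Spec.map eh.hom ≫ aw)
    infer_instance
  -- `fh ≫ π_J = Spec (algebraMap R R[J/x])`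
  have hfhπ : fh ≫ affineBlowup.π J = Spec.map (CommRingCat.ofHom (algebraMap R (blowupAlgebra J x))) := by
    show (Spec.map eh.hom ≫ aw) ≫ affineBlowup.π J = _
    rw [Category.assoc, affineBlowup.awayι_reesT_π, ← Spec.map_comp]
    congr 1
    rw [← reesChartEquiv_comp_reesChartBase (I := J) x hx]
    rfl
  let z₀ : Spec (.of (blowupAlgebra J x)) := Spec.map eh.inv q
  have hz₀q : Spec.map eh.hom z₀ = q := by
    show (Spec.map eh.inv ≫ Spec.map eh.hom) q = q
    rw [← Spec.map_comp, Iso.hom_inv_id, Spec.map_id]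
    rfl
  have hfz₀ : fh z₀ = Ψ y := by
    show (Spec.map eh.hom ≫ aw) z₀ = Ψ y
    rw [Scheme.Hom.comp_apply, hz₀q]
    exact hpq
  have hyO : y ∈ Ψ ⁻¹ᵁ fh.opensRange := ⟨z₀, hfz₀⟩
  have hrange : Set.range ⇑((Ψ ⁻¹ᵁ fh.opensRange).ι ≫ Ψ) ⊆ Set.range ⇑fh := by
    rintro _ ⟨w, rfl⟩
    rw [Scheme.Hom.comp_apply]
    exact w.2
  have hfac := IsOpenImmersion.lift_fac fh ((Ψ ⁻¹ᵁ fh.opensRange).ι ≫ Ψ) hrange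
  haveI : IsOpenImmersion (IsOpenImmersion.lift fh ((Ψ ⁻¹ᵁ fh.opensRange).ι ≫ Ψ) hrange) := by
    have : IsOpenImmersion (IsOpenImmersion.lift fh ((Ψ ⁻¹ᵁ fh.opensRange).ι ≫ Ψ) hrange ≫ fh) := by
      rw [hfac]; infer_instance
    exact IsOpenImmersion.of_comp _ fh
  have hpt : ∀ y₃ : (Ψ ⁻¹ᵁ fh.opensRange : Y₁.Opens),
      fh (IsOpenImmersion.lift fh ((Ψ ⁻¹ᵁ fh.opensRange).ι ≫ Ψ) hrange y₃) = Ψ ((Ψ ⁻¹ᵁ fh.opensRange).ι y₃) := by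
    intro y₃
    rw [← Scheme.Hom.comp_apply, hfac, Scheme.Hom.comp_apply]
  refine ⟨_, (Ψ ⁻¹ᵁ fh.opensRange).ι ≫ Φ₁, inferInstance,
    IsOpenImmersion.lift fh ((Ψ ⁻¹ᵁ fh.opensRange).ι ≫ Ψ) hrange, inferInstance, (Ψ ⁻¹ᵁ fh.opensRange).ι,
    inferInstance, ⟨y, hyO⟩, rfl, rfl, ?_, fun y₃ => ⟨?_, ?_⟩⟩
  · have h1 : fh (IsOpenImmersion.lift fh ((Ψ ⁻¹ᵁ fh.opensRange).ι ≫ Ψ) hrange ⟨y, hyO⟩) = fh z₀ := by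
      rw [hpt, Scheme.Opens.ι_apply, hfz₀]
    have h2 := fh.isOpenEmbedding.injective h1
    rw [h2]
    change q.asIdeal.comap eh.inv.hom = 𝔔
    ext b
    rw [Ideal.mem_comap, hmemq]
    change reesChartEquiv (I := J) x hx ((reesChartEquiv (I := J) x hx).symm b) ∈ 𝔔 ↔ b ∈ 𝔔
    rw [RingEquiv.apply_symm_apply]
  · rw [← hpt y₃, ← Scheme.Hom.comp_apply, hfhπ]
    rfl
  · have h := mem_regularLocus_iff_of_flat_of_isPreimmersion fh
      (IsOpenImmersion.lift fh ((Ψ ⁻¹ᵁ fh.opensRange).ι ≫ Ψ) hrange y₃)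
    simp only [Scheme.mem_regularLocus] at h
    rw [← hpt y₃, ← h, Summit.ResolutionOfSingularities.ResolutionOfSingularities.Theorems.AffineToGlobal.AffineSingularLocus.isRegularLocalRing_stalk_Spec_iff]

/-- **Off `V(J)` the affine blow-up has the local rings of the base.** [cite: StacksProject, Tag 02OS] -/
theorem isRegularLocalRing_stalk_iff_of_not_le {R : Type} [CommRing R] (J : Ideal R) (p : affineBlowup J)
    (hJ : ¬ J ≤ (affineBlowup.π J p).asIdeal) :
    IsRegularLocalRing ((affineBlowup J).presheaf.stalk p) ↔
      IsRegularLocalRing (Localization.AtPrime (affineBlowup.π J p).asIdeal) := by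
  set π := affineBlowup.π J with hπdef
  set W : (Spec (.of R)).Opens := ⨆ a : J, (PrimeSpectrum.basicOpen (a : R) : (Spec (.of R)).Opens) with hWdef
  have hyW : p ∈ π ⁻¹ᵁ W := by
    obtain ⟨b, hbJ, hbp⟩ := SetLike.not_le_iff_exists.mp hJ
    show π p ∈ W
    exact Opens.mem_iSup.mpr ⟨⟨b, hbJ⟩, (PrimeSpectrum.mem_basicOpen _ _).mpr hbp⟩
  let jW : ((π ⁻¹ᵁ W : (affineBlowup J).Opens) : Scheme.{0}) ⟶ Spec (.of R) := (π ⁻¹ᵁ W).ι ≫ π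
  have hj : jW = (π ∣_ W) ≫ W.ι := (morphismRestrict_ι π W).symm
  haveI : IsIso (π ∣_ W) := affineBlowup.isIso_morphismRestrict_iSup (I := J)
  haveI : IsOpenImmersion jW := by rw [hj]; infer_instance
  have h1 := mem_regularLocus_iff_of_flat_of_isPreimmersion jW ⟨p, hyW⟩
  have h2 := mem_regularLocus_iff_of_flat_of_isPreimmersion (π ⁻¹ᵁ W).ι ⟨p, hyW⟩
  have h3 : jW ⟨p, hyW⟩ = π p := by
    show π ((π ⁻¹ᵁ W).ι ⟨p, hyW⟩) = π p
    rw [Scheme.Opens.ι_apply]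
  rw [Scheme.Opens.ι_apply] at h2
  rw [h3] at h1
  simp only [Scheme.mem_regularLocus] at h1 h2
  rw [← h2, h1, Summit.ResolutionOfSingularities.ResolutionOfSingularities.Theorems.AffineToGlobal.AffineSingularLocus.isRegularLocalRing_stalk_Spec_iff]

set_option maxHeartbeats 800000 in
/-- **The global round at a point, with bookkeeping of the new roof.** See the module docstring.
[cite: Kato1994, (7.3), (10.1), (10.3)] [cite: GortzWedhorn2020, Prop. 13.91, (13.19) p. 415] -/
theorem exists_chart_of_singular_point' {k : Type} [Field k] {X X₁ : Scheme.{0}} (f : X ⟶ Spec (.of k))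
    [LocallyOfFiniteType f] {π : X₁ ⟶ X} (hπ : IsBlowup π (singularLocusIdeal X f))
    {A : Type} [CommRing A] [IsNoetherianRing A] {n : ℕ}
    {P : AddSubmonoid (Fin n → ℤ)} {φ : Multiplicative P →* A} {𝔭 : Ideal A} [𝔭.IsPrime]
    {C : Type} [CommRing C] [Algebra A C] [IsNoetherianRing C] {Q : AddSubmonoid (Fin n → ℤ)}
    {χ : Multiplicative Q →* C} {u e : Fin n → ℤ} {a d : ℕ} (had : a < d) (hP : P.FG)
    (hsat : ∀ (w : Fin n → ℤ) (k : ℕ), 0 < k → k • w ∈ P → w ∈ P)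
    (hspanP : Submodule.span ℤ (P : Set (Fin n → ℤ)) = ⊤) (hreg : IsLogRegularAt P φ 𝔭) (hPQ : P ≤ Q)
    (hχ : ∀ p : P, χ (Multiplicative.ofAdd ⟨(p : Fin n → ℤ), hPQ p.2⟩) =
      algebraMap A C (φ (Multiplicative.ofAdd p)))
    (hgen : Algebra.adjoin A (Set.range χ) = ⊤)
    (hD : ∀ q ∈ Q, ∃ p ∈ P, q + p ∈ P)
    (hK : ∀ a : A, algebraMap A C a = 0 → ∃ p : P, φ (Multiplicative.ofAdd p) * a = 0)
    (hΩ : ∀ (K : Type) [Field K] (g : A →+* K), (∀ p : P, g (φ (Multiplicative.ofAdd p)) ≠ 0) →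
      ∃ ω : C →+* K, ω.comp (algebraMap A C) = g)
    (hQfg : Q.FG)
    (hQ : ∀ w, w ∈ Q ↔ ∃ g ∈ Submodule.span ℤ (faceMonoid P φ 𝔭 : Set (Fin n → ℤ)), ∃ m l : ℤ,
      0 ≤ l ∧ (a : ℤ) * l ≤ (d : ℤ) * m ∧ w = g + m • u + l • e)
    (hind : ∀ g ∈ Submodule.span ℤ (faceMonoid P φ 𝔭 : Set (Fin n → ℤ)), ∀ m l : ℤ,
      g + m • u + l • e = 0 → m = 0 ∧ l = 0)
    (hspan : ∀ w : Fin n → ℤ, ∃ g ∈ Submodule.span ℤ (faceMonoid P φ 𝔭 : Set (Fin n → ℤ)),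
      ∃ m l : ℤ, w = g + m • u + l • e)
    (hreg' : ∀ (𝔮 : Ideal A) [𝔮.IsPrime], 𝔮 ≤ 𝔭 → ideal P φ 𝔭 ≤ 𝔮 → IsLogRegularAt P φ 𝔮)
    (hrank : n - Module.finrank ℤ (Submodule.span ℤ (faceMonoid P φ 𝔭 : Set (Fin n → ℤ))) ≤ 2)
    (𝔓 : Ideal C) [𝔓.IsPrime] (h𝔓A : 𝔓.comap (algebraMap A C) = 𝔭)
    (h𝔓q : ∀ q : Q, (q : Fin n → ℤ) ∉ Submodule.span ℤ (faceMonoid P φ 𝔭 : Set (Fin n → ℤ)) →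
      χ (Multiplicative.ofAdd q) ∈ 𝔓)
    {Y : Scheme.{0}} (ρ : Y ⟶ X) [Etale ρ] (j : Y ⟶ Spec (.of C)) [IsOpenImmersion j] (y : Y)
    (hjy : (j y).asIdeal = 𝔓)
    (hSing : ∀ y' : Y, ¬ IsRegularLocalRing (Localization.AtPrime (j y').asIdeal) ↔ ideal Q χ 𝔓 ≤ (j y').asIdeal) :
    ∀ x₁ : X₁, π x₁ = ρ y → x₁ ∉ Scheme.regularLocus X₁ →
      ∃ s : Set (Fin n → ℤ), s.Finite ∧ s ⊆ Q ∧
        (∀ h ∈ s, h ∉ Submodule.span ℤ (faceMonoid P φ 𝔭 : Set (Fin n → ℤ))) ∧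
        (∀ q ∈ Q, q ∉ Submodule.span ℤ (faceMonoid P φ 𝔭 : Set (Fin n → ℤ)) → ∃ h ∈ s, q - h ∈ Q) ∧
        ∃ (h : Fin n → ℤ) (hhQ : h ∈ Q) (_ : h ∈ s) (v x : Fin n → ℤ) (c : ℕ), 2 ≤ c ∧ c + 2 ≤ d ∧
          (∀ w, w ∈ blowupChartMonoid Q {q : Q | (q : Fin n → ℤ) ∈ s} ⟨h, hhQ⟩ ↔
            ∃ g ∈ Submodule.span ℤ (faceMonoid P φ 𝔭 : Set (Fin n → ℤ)), ∃ m l : ℤ,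
              0 ≤ m ∧ 0 ≤ m + (c : ℤ) * l ∧ w = g + m • v + l • x) ∧
          (∀ g ∈ Submodule.span ℤ (faceMonoid P φ 𝔭 : Set (Fin n → ℤ)), ∀ m l : ℤ,
            g + m • v + l • x = 0 → m = 0 ∧ l = 0) ∧
          (∀ w : Fin n → ℤ, ∃ g ∈ Submodule.span ℤ (faceMonoid P φ 𝔭 : Set (Fin n → ℤ)),
            ∃ m l : ℤ, w = g + m • v + l • x) ∧
          ∃ (𝔔 : Ideal (blowupAlgebra (Ideal.span ((fun q : Q => χ (Multiplicative.ofAdd q)) ''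
              {q : Q | (q : Fin n → ℤ) ∈ s})) (χ (Multiplicative.ofAdd ⟨h, hhQ⟩)))) (_ : 𝔔.IsPrime),
            𝔔.comap (algebraMap A _) = 𝔭 ∧
            (∀ qq : blowupChartMonoid Q {q : Q | (q : Fin n → ℤ) ∈ s} ⟨h, hhQ⟩,
              (qq : Fin n → ℤ) ∉ Submodule.span ℤ (faceMonoid P φ 𝔭 : Set (Fin n → ℤ)) →
                blowupChart Q χ {q : Q | (q : Fin n → ℤ) ∈ s} ⟨h, hhQ⟩ (Multiplicative.ofAdd qq) ∈ 𝔔) ∧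
            ¬ IsRegularLocalRing (Localization.AtPrime 𝔔) ∧
            ∃ (Y' : Scheme.{0}) (ρ' : Y' ⟶ X₁) (_ : Etale ρ')
              (j' : Y' ⟶ Spec (.of (blowupAlgebra (Ideal.span ((fun q : Q => χ (Multiplicative.ofAdd q)) ''
                {q : Q | (q : Fin n → ℤ) ∈ s})) (χ (Multiplicative.ofAdd ⟨h, hhQ⟩)))))
              (_ : IsOpenImmersion j') (y' : Y'), ρ' y' = x₁ ∧ (j' y').asIdeal = 𝔔 ∧
              ∀ y₃ : Y', ∃ y₀ : Y, ((j' y₃).asIdeal).comap (algebraMap C _) = (j y₀).asIdeal ∧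
                (IsRegularLocalRing (Localization.AtPrime (j' y₃).asIdeal) ↔ ρ' y₃ ∈ Scheme.regularLocus X₁) ∧
                (¬ Ideal.span ((fun q : Q => χ (Multiplicative.ofAdd q)) '' {q : Q | (q : Fin n → ℤ) ∈ s}) ≤
                    (j y₀).asIdeal →
                  (IsRegularLocalRing (Localization.AtPrime (j' y₃).asIdeal) ↔
                    IsRegularLocalRing (Localization.AtPrime (j y₀).asIdeal))) := by
  intro x₁ hx₁ hx₁sing
  classical
  -- (1) the ring-level round: the chain `s`, `J = (χ s) = I(𝔓, χ)`, the points of `Bl_J(Spec C)` over `𝔭`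
  obtain ⟨s, hsfin, hsQ, hsL, hsgen, hcl⟩ := FixedStratumBlowupPoints.stalk_regular_or_fixedPrime_of_stratum had
    hP hsat hspanP hreg hPQ hχ hgen hD hK hΩ hQfg hQ hind hspan hreg' hrank
  set J : Ideal C := Ideal.span ((fun q : Q => χ (Multiplicative.ofAdd q)) '' {q : Q | (q : Fin n → ℤ) ∈ s})
    with hJdef
  have hJeq : J = ideal Q χ 𝔓 := FixedStratumCentre.span_chain_eq_ideal hPQ hχ hsQ hsL hsgen h𝔓A h𝔓q
  -- (2) `J` is radical near `𝔓`
  have hd : 0 < d := by omega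
  have hS : ∀ q₁ ∈ Q, ∀ q₂ ∈ Q, q₁ + q₂ ∈ Submodule.span ℤ (faceMonoid P φ 𝔭 : Set (Fin n → ℤ)) →
      q₁ ∈ Submodule.span ℤ (faceMonoid P φ 𝔭 : Set (Fin n → ℤ)) := ConeChainCharts.cone_face hd hQ hind
  have hH : ∀ q ∈ Q, ∀ p ∈ P, q + p ∈ Submodule.span ℤ (faceMonoid P φ 𝔭 : Set (Fin n → ℤ)) →
      q ∈ Submodule.span ℤ (faceMonoid P φ 𝔭 : Set (Fin n → ℤ)) :=
    fun q hq p hp hqp => hS q hq p (hPQ hp) hqp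
  have hrad𝔓 : (J.map (algebraMap C (Localization.AtPrime 𝔓))).IsRadical :=
    (FixedStratumCentre.isRadical_map_span_chain hP hsat hreg hreg' hPQ hχ hgen hD hK hS hH hsQ hsL hsgen
      h𝔓A h𝔓q).2
  obtain ⟨g, hg𝔓, hradg⟩ := FixedStratumRadicalNearby.exists_isRadical_map_away J 𝔓 hrad𝔓
  -- (3) shrink the roof to `D(g)`
  have hgy : g ∉ (j y).asIdeal := by rw [hjy]; exact hg𝔓
  obtain ⟨Y', ρ', _, j', _, ι, _, y', hρ', hj', hιy', hcomap⟩ := RoofShrink.exists_roof_shrink ρ j g y hgy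
  have hZ' : ∀ y'' : Y', ¬ IsRegularLocalRing (Localization.AtPrime (j' y'').asIdeal) ↔
      J.map (algebraMap C (Localization.Away g)) ≤ (j' y'').asIdeal := by
    refine RoofShrink.singular_iff_le_of_shrink g J j' fun y'' => ?_
    have key : ∀ (I : Ideal C) (hI : I.IsPrime), I = (j (ι y'')).asIdeal →
        (¬ IsRegularLocalRing (Localization.AtPrime I) ↔ J ≤ I) := by
      rintro I hI rfl
      rw [hJeq]
      exact hSing (ι y'')
    exact key _ _ (hcomap y'')
  -- (4) `Y₁ = X₁ ×_X Y'`: étale over `X₁`, open in `Bl_{J C_g}`, hence in `Bl_J(Spec C)`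
  obtain ⟨Y₁, Φ₁, _, Φ₂, _, ρ₁, hΦ₁π, hΦ₂π, hregiff, hsurj⟩ :=
    SingBlowupRoofPullback.exists_roof_pullback f hπ ρ' j' (J.map (algebraMap C (Localization.Away g))) hradg hZ'
  obtain ⟨Φ₃, hΦ₃oi, hΦ₃π, hΦ₃reg, -⟩ :=
    EtaleBlowupComparison.exists_openImmersion_comparison (algebraMap C (Localization.Away g)) J
  haveI := hΦ₃oi
  -- (5) the point `y₁` of `Y₁` over `(x₁, y')` and its image `p'` in `Bl_J(Spec C)`, which lies over `𝔓`
  have hx₁' : π x₁ = ρ' y' := by rw [hρ', Scheme.Hom.comp_apply, hιy']; exact hx₁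
  obtain ⟨y₁, hy₁x, hy₁y⟩ := hsurj x₁ y' hx₁'
  have hπpt : ∀ w : Y₁, affineBlowup.π J (Φ₃ (Φ₂ w)) = j (ι (ρ₁ w)) := by
    intro w
    have h1 : affineBlowup.π J (Φ₃ (Φ₂ w)) =
        Spec.map (CommRingCat.ofHom (algebraMap C (Localization.Away g))) (j' (ρ₁ w)) := by
      rw [← Scheme.Hom.comp_apply, hΦ₃π, Scheme.Hom.comp_apply, ← Scheme.Hom.comp_apply Φ₂, hΦ₂π,
        Scheme.Hom.comp_apply]
    rw [h1]
    apply PrimeSpectrum.ext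
    rw [← hcomap (ρ₁ w)]
    rfl
  have hp'π : (affineBlowup.π J (Φ₃ (Φ₂ y₁))).asIdeal = 𝔓 := by
    rw [hπpt, hy₁y, hιy', hjy]
  have hp'A : (affineBlowup.π J (Φ₃ (Φ₂ y₁))).asIdeal.comap (algebraMap A C) = 𝔭 := by rw [hp'π, h𝔓A]
  -- (6) classification: `p'` is not regular, so it is the image of a singular fixed prime with `2 ≤ c ≤ d - 2`
  rcases hcl (Φ₃ (Φ₂ y₁)) hp'A with hregp | ⟨h, hhQ, hhs, v, x, c, hc2, hcd, hQh, hindvx, hspanvx, q, 𝔔, h𝔔,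
      hpq, hmemq, h𝔔A, h𝔔q, hsing⟩
  · exact absurd ((hregiff y₁).mpr ((hΦ₃reg (Φ₂ y₁)).mpr hregp)) (hy₁x ▸ hx₁sing)
  · -- (7) the étale roof at `x₁` through the chart at `h`
    have hχh : χ (Multiplicative.ofAdd ⟨h, hhQ⟩) ∈ J :=
      Ideal.subset_span (Set.mem_image_of_mem (fun q : Q => χ (Multiplicative.ofAdd q))
        (show (⟨h, hhQ⟩ : Q) ∈ {q : Q | (q : Fin n → ℤ) ∈ s} from hhs))
    have hpq' : Proj.awayι (reesGrading J) (reesT (χ (Multiplicative.ofAdd ⟨h, hhQ⟩)) hχh)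
        (reesT_mem (χ (Multiplicative.ofAdd ⟨h, hhQ⟩)) hχh) one_pos q = (Φ₂ ≫ Φ₃) y₁ := by
      rw [Scheme.Hom.comp_apply]; exact hpq
    obtain ⟨Y'', ρ'', _, j'', _, ι'', _, y₁', hρ'', hι''y, hj''y, hbook⟩ :=
      SingBlowupRoundRoof.exists_roof_of_chart_point' J _ hχh (Φ₂ ≫ Φ₃) Φ₁ y₁ q 𝔔 hpq' hmemq
    refine ⟨s, hsfin, hsQ, hsL, hsgen, h, hhQ, hhs, v, x, c, hc2, hcd, hQh, hindvx, hspanvx, 𝔔, h𝔔, h𝔔A, h𝔔q,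
      hsing, Y'', ρ'', inferInstance, j'', inferInstance, y₁', ?_, hj''y, fun y₃ => ?_⟩
    · rw [hρ'', Scheme.Hom.comp_apply, hι''y, hy₁x]
    · obtain ⟨hb1, hb2⟩ := hbook y₃
      rw [Scheme.Hom.comp_apply, hπpt] at hb1
      rw [Scheme.Hom.comp_apply] at hb2
      refine ⟨ι (ρ₁ (ι'' y₃)), hb1.symm, ?_, fun hJy₀ => ?_⟩
      · rw [← hb2, ← hΦ₃reg, ← hregiff, hρ'', Scheme.Hom.comp_apply, Scheme.mem_regularLocus]
      · rw [← hb2]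
        have hJ' : ¬ J ≤ (affineBlowup.π J (Φ₃ (Φ₂ (ι'' y₃)))).asIdeal := by rw [hπpt]; exact hJy₀
        rw [SingBlowupRoundRoof.isRegularLocalRing_stalk_iff_of_not_le J _ hJ', hπpt]

end Summit.ResolutionOfSingularities.ResolutionOfSingularities.Theorems.FRationalResolution.SingBlowupRoundRoof

end
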